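import Mathlib
import HarnessLib
import HarnessLib.Audit
import Summits.MatrixMultiplication.Statement
import Literature.Computability.AlgebraicComplexity.GroupAlgebraTensor
import Summits.MatrixMultiplication.MatrixMultiplication.Theorems.AsymptoticRankCWOmegaGeTwo
import HarnessLib.Audit.Status.Attr

/-!
Route: ApproximationProfile

DORMANT since 2026-08-22T20:56:36Z (reconciler: no traction for 5.6 d (last activity item-evidence-added at 2026-08-17T04:37:29Z); parked, not closed — `ledger route dormant route-MatrixMultiplication-ApproximationProfile --off` to reac) — unstaffed, not closed; items shared with open routes are served there. `ledger route dormant <id> --off` reactivates.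

# Route ApproximationProfile — approximation profile of <n,n,n> — rigidity (fixed-error rank
exponent = omega) and softness (some fixed error at exponent 2) give omega = 2

X = Rigidity ∧ Softness ("it suffices to show X"; card approximation-profile-rigidity, absorbing the
residual delta of its retired
twin approximate-exponent). Fix the Frobenius (Hilbert–Schmidt) norm on ℂ^{n²}⊗ℂ^{n²}⊗ℂ^{n²};
‖⟨n,n,n⟩‖² = n³ and ‖⟨n,n,n⟩ − S‖² is the
mean-square error of the bilinear map S on Gaussian inputs. The APPROXIMATION PROFILE is r_n(η) :=
min{R(S) : ‖⟨n,n,n⟩ − S‖² ≤ η n³}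
(0 < η < 1) with exponent ω^ap(η) := inf{β : r_n(η) = O(n^β)}. Elementary frame: 2 ≤ ω^ap(η) ≤ ω
(upper: S = ⟨n,n,n⟩; lower:
Eckart–Young on the flattening, whose n² singular values all equal √n, gives r_n(η) ≥ (1−η)n², item
LowerFrame).
RIGIDITY (crux Rigidity): ω^ap(η) = ω for every η ∈ (0,1) — stated as "rank-O(n^β) tensors within
error η n³ for all large n ⇒
ω(ℂ) ≤ β". SOFTNESS (crux Softness): ω^ap(η) ≤ 2 for ONE η ∈ (0,1). Rigidity ∧ Softness ⟺ ω(ℂ) = 2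
(⇐ is trivial), so X splits the
summit into a strong-converse statement and a sketchability statement of opposite flavour; r_n(η) is
inlined (∃ S, R(S) ≤ C n^β ∧
error ≤ η n³), so no new definition is load-bearing.
Lean: `(∀ η β : ℝ, 0 < η → η < 1 → (∃ C : ℝ, ∃ N : ℕ, ∀ n : ℕ, N ≤ n → ∃ S : Fin n × Fin n → Fin n ×
Fin n → Fin n × Fin n → ℂ, (Literature.Computability.AlgebraicComplexity.tensorRank S : ℝ) ≤ C * (n
: ℝ) ^ β ∧ ∑ a, ∑ b, ∑ c, ‖Literature.Computability.AlgebraicComplexity.matMulTensor ℂ n n n a b c -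
S a b c‖ ^ 2 ≤ η * (n : ℝ) ^ 3) → Literature.Computability.AlgebraicComplexity.omega ℂ ≤ β) ∧ (∃ η :
ℝ, 0 < η ∧ η < 1 ∧ ∀ ε : ℝ, 0 < ε → ∃ C : ℝ, ∃ N : ℕ, ∀ n : ℕ, N ≤ n → ∃ S : Fin n × Fin n → Fin n ×
Fin n → Fin n × Fin n → ℂ, (Literature.Computability.AlgebraicComplexity.tensorRank S : ℝ) ≤ C * (n
: ℝ) ^ (2 + ε) ∧ ∑ a, ∑ b, ∑ c, ‖Literature.Computability.AlgebraicComplexity.matMulTensor ℂ n n n a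
b c - S a b c‖ ^ 2 ≤ η * (n : ℝ) ^ 3)`

## Assembly
Pure logic plus 2 ≤ ω(ℂ) (sorry-free in Sketch.lean, `assembly_holds`): Softness gives η ∈ (0,1)
and, for each ε > 0, rank-O(n^{2+ε})
approximants within error η n³; Rigidity at (η, β = 2+ε) gives ω(ℂ) ≤ 2+ε; so ω(ℂ) ≤ 2, and
`Literature.CplxAlg.two_le_omega ℂ`
(Theorems/AsymptoticSpectrumOmegaGeTwo.lean, item OmegaGeTwo) gives ω(ℂ) = 2 = MatrixMultiplication.

Rationale: WHY THIS LINE. A metric relaxation strictly between entrywise approximation (trivial) and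
exact/border rank (ω): Schönhage's partial matrix
multiplication theorem (Schonhage1981; BurgisserClausenShokrollahi1997 Thm (15.48)) already says
that 0/1-approximants obtained by
zeroing input patterns are as hard as ⟨n,n,n⟩ in the exponent — Rigidity is its metric
generalisation to arbitrary tensors within
fixed relative error, and Softness is the statement every sketching paper would like but none
reaches (Pagh arXiv:1108.1320 and
Cohen–Nelson–Woodruff arXiv:1507.02268 realise only the incoherent rate error × rank ≈ n³). Imported
areas: low-rank approximation
theory (Eckart–Young–Mirsky Mirsky1960, de Silva–Lim DesilvaLim2008) for the frame; representation
theory of the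
stabiliser U(n)³ (twirling: items Flatness, DecoherenceStep — the provable calculus "error η → η′
costs O(1) in rank, or a constant
factor in size"); non-abelian harmonic analysis à la Cohn–Umans (CohnUmans2003,
CohnKleinbergSzegedyUmans2005, arXiv:1207.6528) as the
one known COHERENT source of approximants (crux GroupSoftness, with an elementary Fourier-positivity
no-go for abelian groups); random
matrix / perturbation theory of Koszul–commutator flattenings (Strassen1983, LandsbergOttaviani2015)
for the metric
lower-bound prong (crux MetricStrassen). None of the nine existing MatrixMultiplication routes has a
fixed-error observable (all are
rank / border rank / asymptotic rank / STPP / apolarity statements); the negatives index is empty.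

RANKED CRUXES. #0 ApproximationDichotomy (target) — X = Rigidity ∧ Softness as in § Thesis (the two
conjuncts are literally the cruxes Rigidity and Softness). (why it might fail: both conjuncts are
necessary for ω = 2, so X is exactly as true as the summit; the risk is informativeness — Rigidity
may be unreachable without knowing ω, Softness without an ω = 2 algorithm.) [Schonhage1981,
BurgisserClausenShokrollahi1997, DesilvaLim2008, arXiv:1108.1320]
#2 Rigidity (crux) — for every η ∈ (0,1) and β: if for all large n some tensor S_n of rank ≤ C n^β
has ‖⟨n,n,n⟩ − S_n‖² ≤ η n³, then ω(ℂ) ≤ β (ω^ap(η) = ω: approximation to constant relative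
mean-square error buys no exponent; card item R). Equivalent, given Flatness and LowerFrame, to the
transfer form "from an η-approximant of rank r at size n, an exact ⟨m,m,m⟩ with m ≥ n^{1−δ} of rank
≤ C_δ n^δ r". [difficulty: open-problem] (why it might fail: if ω>2, dropping or perturbing an
η-fraction of the n³ products may lower the exponent (support deletion does lower ranks: ⟨2,2,2⟩
minus the two c₂₂-terms has border rank 5, BiniEtAl1979; KarppaKaski2019); the only transfer known
is the incoherent rate error×rank = const.) [Schonhage1981, BurgisserClausenShokrollahi1997,
BiniEtAl1979, KarppaKaski2019, DesilvaLim2008]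
#3 Softness (crux) — there is ONE η ∈ (0,1) such that for every ε > 0 and all large n some tensor of
rank ≤ C_ε n^{2+ε} is within squared Frobenius distance η n³ of ⟨n,n,n⟩ (ω^ap(η) ≤ 2: coherent
approximate matrix multiplication at quadratic cost; card item S). [difficulty: open-problem] (why
it might fail: if ω>2 and Rigidity holds it is false; every known sub-cubic approximant is
incoherent (sketches: error·rank ≈ n³, Pagh 2013, Cohen–Nelson–Woodruff 2016) or an exact algorithm
on a (1−η)-sub-product (rank ≈ (1−η)n^ω); NuclearMass forces term mass ≥ (1−√η)n³.) [Pagh2013,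
arXiv:1108.1320, arXiv:1507.02268, AlonEtAl2013, Blaser2013]
#4 GroupSoftness (crux) — approximate Cohn–Umans embeddings as the coherent source for Softness: ONE
η ∈ (0,1) such that for every ε > 0 and all large n there are a finite group G with R(ℂ[G]) ≤ C_ε
n^{2+ε} (structure tensor `groupTensor ℂ G`) and three n-tuples s, t, u in G for which the equation
(s_b⁻¹ t_{b′})(t_c⁻¹ u_{c′}) = s_a⁻¹ u_{a′} has at most η n³ NON-trivial index solutions (trivial =
the n³ matrix-multiplication triples); the restriction of the group tensor along the Cohn–Umans maps
is then an η-approximant of ⟨n,n,n⟩ (item GroupSoftnessGlue). [deps: Softness] [difficulty: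
open-problem] (why it might fail: needs |S||T||U| = n³ at the TPP packing limit |G|^{3/2−o(1)}
together with R(ℂ[G]) = |G|^{1+o(1)}; abelian G are impossible (Fourier positivity: ≥ n⁶/|G| − n³
spurious solutions, so |G| ≥ n³/(1+η)) and small-irrep groups are nearly abelian
(arXiv:2204.03826-type barriers).) [CohnUmans2003, CohnKleinbergSzegedyUmans2005, arXiv:1207.6528,
BlasiakCohnGrochowPrattUmans2023, arXiv:1712.02302]
#5 MetricStrassen (crux) — some lower bound beyond the flattening bound survives constant error:
there are θ > 0, γ > 0 and N such that for n ≥ N every tensor S with ‖⟨n,n,n⟩ − S‖² ≤ θ n³ has R(S)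
≥ (1+γ) n² (Eckart–Young gives only (1−θ)n²; expected via Mirsky-stable Koszul/commutator
flattenings after a random restriction ℂ^{n²} → ℂ³ of one factor, heuristically (3/2 −
O(θ^{1/3}))n²). First rung of the metric refutation prong r_n(η) ≥ n^{2+δ} (which would imply route
BorderRankLowerBound's FThesis and ¬ω=2). [difficulty: L] (why it might fail: Mirsky stability of
the commutator/Koszul flattening needs its small singular values sparse near 0 after the random
restriction ℂ^{n²}→ℂ³; a hard-edge pile-up, or errors aligned with every well-conditioned
restriction, would cap error-robust bounds at (1−θ)n²+o(n²).) [Strassen1983, LandsbergOttaviani2015,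
Mirsky1960, EfremenkoGargOliveiraWigderson2018]
#9 LowerFrame (support) — Eckart–Young floor: for every n and every tensor S, (n² − R(S))·n ≤
‖⟨n,n,n⟩ − S‖² (the flattening of ⟨n,n,n⟩ has n² singular values √n and a rank-r tensor has
flattening rank ≤ r); hence r_n(η) ≥ (1−η)n² and ω^ap(η) ≥ 2. [difficulty: provable-now]
[Mirsky1960, DesilvaLim2008, Blaser2013]
#9 NuclearMass (support) — mass constraint on approximants (retired card approximate-exponent): the
spectral norm of ⟨n,n,n⟩ is 1 (|Σ A_{κμ}B_{μν}C_{κν}| = |tr(ABCᵀ)| ≤ ‖A‖‖B‖‖C‖), so any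
decomposition Σ_{i<r} u_i⊗v_i⊗w_i within squared error η n³ of ⟨n,n,n⟩ has Σ_i ‖u_i‖‖v_i‖‖w_i‖ ≥
(1−√η) n³ — rank-n^{2+o(1)} softness needs terms of average mass n^{1−o(1)}. [difficulty:
provable-now] [Derksen2015, Blaser2013]
#9 Flatness (support) — error amplification at constant rank cost (ω^ap is constant on (0,1)): for η
∈ (0,1) and η′ > 0 there is N = N(η,η′) (N = ⌈η/(η′(1−η))⌉ works) such that every S with error ≤ η
n³ yields S′ with R(S′) ≤ N·R(S) and error ≤ η′ n³. Proof sketch: rescale S so that ⟨⟨n,n,n⟩ − S, S⟩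
= 0; average N conjugates g_i·S over a finite irreducible subgroup of the stabiliser U(n)³ (signed
permutations suffice: first moments only), whose invariants on ℂ^{n²}⊗ℂ^{n²}⊗ℂ^{n²} are ℂ·⟨n,n,n⟩;
the component of the error orthogonal to ⟨n,n,n⟩ averages out at rate 1/N; rescale. [difficulty: M]
[Blaser2013, DesilvaLim2008]
#9 DecoherenceStep (support) — the card's decoherence lemma (v) in safe form: for η ∈ (0,1), η′ > 0
there is κ > 0 (κ = min(1, η′(1−η)/η) works) such that every S with error ≤ η n³ at size n yields,
for every m ≤ min(n, κ n), a tensor S′ at size m with R(S′) ≤ R(S) and error ≤ η′ m³. Proof sketch: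
rescale, twirl by a Haar (or unitary-2-design) element of U(n)³, restrict to an m-sub-product; each
error sector with k ≥ 1 traceless legs keeps an expected energy fraction
(m/n)^{3−k}·(m(mn−1)/(n(n²−1)))^k ≤ (m/n)^4, versus (m/n)³ for ⟨n,n,n⟩, so the relative error drops
by m/n. [difficulty: L] [Blaser2013, DesilvaLim2008]
#9 PatternRigidity (support) — Rigidity restricted to Schönhage's partial matrix multiplications
(0/1-approximants keeping the products (κ,μ,ν) with (κ,μ) ∈ I, (μ,ν) ∈ J, f = |T| ≥ (1−η)n³ of the
n³ ones): rank ≤ C n^β for all large n ⇒ ω ≤ β. A special case of Rigidity (error = n³ − f) AND a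
consequence of BurgisserClausenShokrollahi1997 Thm (15.48) (f^{ω/3} ≤ R̲ ≤ R, so ω ≤ 3 log(C
n^β)/log((1−η)n³) → β); provable once that theorem is available as a Literature fact (cite item
filed). [difficulty: L] [Schonhage1981, BurgisserClausenShokrollahi1997]
#9 GroupSoftnessGlue (support) — glue of the foreseen one-child split Softness ⇐ GroupSoftness: the
restriction of `groupTensor ℂ G` along b=(s,t) ↦ s_b⁻¹t_{b′}, c=(t,u) ↦ t_c⁻¹u_{c′}, a=(s,u) ↦
s_a⁻¹u_{a′} has rank ≤ R(ℂ[G]) (`tensorRank_comp_le`), agrees with ⟨n,n,n⟩ on the trivial triples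
and has squared error = the number of non-trivial solutions (CohnUmans2003 Thm 2.3 with the TPP
hypothesis dropped). [difficulty: provable-now] [CohnUmans2003]
#9 OmegaGeTwo (support) — shared lower frame of all positive routes
(stmt-MatrixMultiplication-0586): admissibleExponents ℂ is bounded below and 2 ≤ ω(ℂ) (flattening
bound; proved in Theorems/AsymptoticSpectrumOmegaGeTwo.lean). [difficulty: provable-now]
[Blaser2013]

TWO-LAYER PLAN. Foreseen glued splits (nothing filed now): Softness ⇐ GroupSoftness (glue =
GroupSoftnessGlue, provable now); Softness ⇐ PatternSoftness
(a Schönhage pattern (I,J) with f ≥ (1−η)n³ and rank n^{2+o(1)} — the 0/1 branch) as the alternative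
child; Rigidity ⇐ Flatness → Snap →
Rigidity, where Snap is the small-error transfer "∃θ: every S within θ m³ of ⟨m,m,m⟩ computes
⟨m/2,m/2,m/2⟩ exactly at rank ≤ C_δ m^δ R(S)"
(equivalent to Rigidity at exponent level, so it is filed only if a proof strategy distinguishes
it); MetricStrassen ⇐ (random
restriction lemma: E‖(φ⊗1⊗1)E‖² = 3‖E‖²/n²) → (bulk singular-value count of the restricted
commutator flattening) → MetricStrassen.

KILL CRITERIA. A metric lower bound ∃ η<1, δ>0, c>0 with r_n(η) ≥ c n^{2+δ} for all n refutes
Softness AND the summit (it implies FThesis of route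
BorderRankLowerBound verbatim) — close `refuted:Softness` and hand the certificate to that route.
Rigidity refuted (ω^ap(η) < ω for
some η) likewise needs ω > 2 and closes everything positive. GroupSoftness refuted (e.g. a theorem
that η-approximate TPP n-triples force
R(ℂ[G]) ≥ n^{2+c}) is NOT load-bearing: drop it and pivot Softness to the pattern/sketch branch.
MetricStrassen refuted (error-robust
bounds capped at (1−θ)n² + o(n²)) kills only the metric refutation prong: drop the item. Any
positive route proving ω = 2 moots the route
(both cruxes then hold trivially); numerics showing E_n(r) glued to the truncation line 1 − r/n³ up
to r ≈ n^{2.5} for n ≤ 6 would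
demote Softness below GroupSoftness in rank but refute nothing.

NOT DECOMPOSED YET. The transfer/snap engine for Rigidity beyond the incoherent calculus (Flatness,
DecoherenceStep) — which self-correction identity, if
any, reduces error coherently (η → η² at O(1) rank cost) is the open heart of rank 2 and is
deliberately not pre-split; the choice of
carrier groups for GroupSoftness (unbounded-exponent nearly-abelian vs. small non-abelian factors);
the 0/1 pattern branch
PatternSoftness and arbitrary-support deletions (Karppa–Kaski probabilistic rank); the explicit
constants N(η,η′), κ(η,η′) (stated
existentially on purpose); certified numerics of the profile E_n(r) for n = 2,3,4 (requested only
after rank 2 is grounded); the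
incoherence barrier as a theorem for oblivious sketches (inner-dimension sketches A P B with rk P ≤
k have error ≥ n²(n−k): Eckart–Young
again) — a remark, not an item.

CHEAPEST FALSIFIER. Lookup + two pages: does Rigidity already FOLLOW from Schönhage's Thm (15.48) by
rounding — i.e. does every S within η n³ of ⟨n,n,n⟩
restrict (possibly after ⊕ with a small tensor) to a partial matrix multiplication of filling f ≥
(1−η′)n³? I checked the obvious
version: no — a general S need not compute any single product a_{κμ}b_{μν} exactly, so Lemma
(15.47)-type restrictions do not apply
verbatim; if a refuter finds such a rounding, Rigidity becomes `known` (still worth a Literature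
theorem) and the route collapses to
Softness alone (under floor ⇒ conditional bridge or close). Numerically: ALS with restarts for
E_3(r), r ∈ [12, 23], and E_4(r),
r ∈ [16, 49] (minutes): a profile hugging 1 − r/n³ far beyond r = n² supports Rigidity, an early
collapse supports Softness.

NUMBERS. Frame: (1−η)n² ≤ r_n(η) ≤ R(⟨n,n,n⟩); E_n(1) = 1 − 1/n³ (spectral norm of ⟨n,n,n⟩ is 1);
truncation E_n(r) ≤ 1 − r/n³. Exact side:
R(⟨2,2,2⟩) = R̲ = 7 (so E_2(6) > 0), R̲(⟨3,3,3⟩) ∈ [17, 20], R(⟨3,3,3⟩) ∈ [19, 23]; R̲(⟨n,n,n⟩) ≥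
2n² − ⌈log₂ n⌉ − 1 (Landsberg–Michałek
2018), ≥ 2n² − n (LandsbergOttaviani2015), Strassen's 3n²/2 (Strassen1983); rank methods capped at
8n²
(EfremenkoGargOliveiraWigderson2018) and determinantal ones at 6n² − 4 (LinearRankMethodBarrier).
ω(ℂ) < 2.371339
(AlmanDuanVassilevskaWilliamsXuXuZhou2025). Sketch rate: Pagh's compressed product as a bilinear map
has rank n·b and total squared error
≈ n²‖AB‖²/b, i.e. error η at rank ≈ n³/η (arXiv:1108.1320 Thm 3.1-type bound). Partial MM: f^{ω/3} ≤
R̲ (BurgisserClausenShokrollahi1997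
Thm (15.48), p. 409). Flatness constant N(η,η′) = ⌈η/(η′(1−η))⌉; decoherence ratio κ = η′(1−η)/η.
Items at open: 13 (1 target, 4 cruxes,
7 support, 1 assembly).

DEFINITION REQUESTS. approxRank (Literature/Computability/AlgebraicComplexity): `approxRank (η : ℝ)
(t : ι → κ → μ → ℂ) : ℕ := sInf {r | ∃ S, tensorRank S ≤ r ∧
∑ ‖t − S‖² ≤ η ∑ ‖t‖²}` and the profile E(t, r) := inf over rank ≤ r of the relative squared
distance — would shorten every signature
here (filed with `workitem add --kind definition` after open; nothing is blocked on it, all items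
inline the notion). Cite fact wanted:
Schönhage's partial matrix multiplication theorem, BurgisserClausenShokrollahi1997 Thm (15.48) (for
PatternRigidity).

Novelty: Searches (2026-08-15): `lit search --source zbmath` for "approximate rank of a tensor" (4, none on
point: Schönhage 1981 partial MM,
Friedland–Mehrmann subspace approximation), "epsilon-rank tensor" (3, Khoromskij numerics), "tensor
rank ill-posedness best low-rank
approximation" (de Silva–Lim 2008), "low rank approximation matrix multiplication tensor Frobenius
error" (0 on point), "approximate
bilinear algorithms fixed error exponent" (0), "distance to secant variety matrix multiplication
tensor" (0), "noisy tensor rank lower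
bound perturbation" (0), "compressed matrix multiplication" (Pagh 2013), "optimal approximate matrix
product in terms of stable rank"
(CNW 2016), "approximate rank of a matrix algorithmic applications" (ALSV 2013), "probabilistic rank
tensor Boolean matrix multiplication"
(Karppa–Kaski 2019); `lit search --hybrid "best rank-r approximation of the matrix multiplication
tensor relative error"` (8 held books,
none on point: Landsberg 2017, Golub–Van Loan); `lit galaxy search "approximate tensor rank" --star
all` (3 pdf hits, only neighbour
arXiv:1811.07515 = probabilistic rank; panama/crabby saturated), a second galaxy query timed out
(saturated); `lit frontier
MatrixMultiplication --since 2021` (30 rows: compressed MM engineering arXiv:2601.09477, nonlinear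
equations beyond cactus arXiv:2602.12762
— nothing with a fixed-error exponent); `lit bridges MatrixMultiplication --cross any`; `lit read`
of BurgisserClausenShokrollahi1997
§15.9 pp. 407–410 (Thm (1  [refs: 1811.07515, 2601.09477, 2602.12762, 1108.1320, 1507.02268, 1207.6528, BurgisserClausenShokrollahi1997, Schonhage1981, DesilvaLim2008, BiniEtAl1979, AlonEtAl2013, KarppaKaski2019, CohnUmans2003]

Barriers (technique_class: metric-approximation, frobenius-eps-rank, self-correction): - technique_class: metric-approximation, frobenius-eps-rank, self-correction
- Literature.Barriers.MatrixMultiplication.LinearRankMethodBarrier: bites on the METHOD foreseen for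
MetricStrassen (commutator/Koszul flattenings are determinantal, capped at 6n²−4, EGOW at 8n²) —
harmless there since only (1+γ)n² is asked; the full metric prong r_n(η) ≥ n^{2+δ} does not evade it
by theorem: the bet is that distance/inequality certificates (ED-critical points of σ_r near
⟨n,n,n⟩) are formally outside the class "rk L(t)/k", untested.
- Literature.Barriers.MatrixMultiplication.InfimumNotMinimumBarrier: respected — every item is
asymptotic in n (exponents via ∀ε / all large n); no single finite approximant certifies ω.
- Literature.Barriers.MatrixMultiplication.TricoloredSumFreeBarrier: applies to GroupSoftness only
if the carrier groups are abelian of bounded exponent — but abelian carriers are excluded outright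
by Fourier positivity (≥ n⁶/|G| − n³ spurious solutions), so the crux lives in non-abelian or
unbounded-exponent territory where Thm A/B are silent.
- Literature.Barriers.MatrixMultiplication.QuasirandomBarrier: applies in spirit — R(ℂ[G]) ≤ C
n^{2+ε} with |G| ≥ (1−η)n² forces all character degrees n^{o(1)}, so Lie-type / quasirandom carriers
are dead for GroupSoftness exactly as for exact TPP; it does not evade, the bet is nearly-abelian
carriers with η-slack.
- Literature.Barriers.MatrixMultiplication.NormalizerBarrier: stated for subgroup TPP triples;
GroupSoftness uses arb

History (route lifecycle, newest last):
- 2026-08-22T20:56:36Z · DORMANT — reconciler: no traction for 5.6 d (last activity item-evidence-added at 2026-08-17T04:37:29Z); parked, not closed — `ledger route dormant route-MatrixMultiplica (operator:999:3943527)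

sub-problem: MatrixMultiplication · status: dormant · opened planner-plancard-MatrixMultiplication-MatrixM-393d63dd-0 2026-08-15T11:39:05Z · rev 1 · ledger route-MatrixMultiplication-ApproximationProfile
GENERATED by the gate from the ledger (D-0016/17). Provers cite these decls: `theorem foo : Summit.MatrixMultiplication.MatrixMultiplication.Theses.ApproximationProfile.<Decl> := …` in Summits/MatrixMultiplication/MatrixMultiplication/Theorems/<Name>.lean.
-/

namespace Summit.MatrixMultiplication.MatrixMultiplication.Theses.ApproximationProfile

open scoped BigOperators Topology Manifold Classical MeasureTheory ProbabilityTheory Matrix InnerProductSpace ComplexConjugate ContinuousMap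
open Filter Set Function TopologicalSpace MeasureTheory

attribute [summit_statement] _root_.MatrixMultiplication

/-- item stmt-MatrixMultiplication-5013 · target · rank 0 · open · by planner
why it might fail: both conjuncts are necessary for ω = 2, so X is exactly as true as the summit; the risk is informativeness — Rigidity may be unreachable without knowing ω, Softness without an ω = 2 algorithm.
sources: Schonhage1981, BurgisserClausenShokrollahi1997, DesilvaLim2008, arXiv:1108.1320
[target] X = Rigidity ∧ Softness as in § Thesis (the two conjuncts are literally the cruxes Rigidity
and Softness). -/
@[route_item "route-MatrixMultiplication-ApproximationProfile"]
def ApproximationDichotomy : Prop :=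
  (∀ η β : ℝ, 0 < η → η < 1 → (∃ C : ℝ, ∃ N : ℕ, ∀ n : ℕ, N ≤ n → ∃ S : Fin n × Fin n → Fin n × Fin n → Fin n × Fin n → ℂ, (Literature.Computability.AlgebraicComplexity.tensorRank S : ℝ) ≤ C * (n : ℝ) ^ β ∧ ∑ a, ∑ b, ∑ c, ‖Literature.Computability.AlgebraicComplexity.matMulTensor ℂ n n n a b c - S a b c‖ ^ 2 ≤ η * (n : ℝ) ^ 3) → Literature.Computability.AlgebraicComplexity.omega ℂ ≤ β) ∧ (∃ η : ℝ, 0 < η ∧ η < 1 ∧ ∀ ε : ℝ, 0 < ε → ∃ C : ℝ, ∃ N : ℕ, ∀ n : ℕ, N ≤ n → ∃ S : Fin n × Fin n → Fin n × Fin n → Fin n × Fin n → ℂ, (Literature.Computability.AlgebraicComplexity.tensorRank S : ℝ) ≤ C * (n : ℝ) ^ (2 + ε) ∧ ∑ a, ∑ b, ∑ c, ‖Literature.Computability.AlgebraicComplexity.matMulTensor ℂ n n n a b c - S a b c‖ ^ 2 ≤ η * (n : ℝ) ^ 3)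

/-- item stmt-MatrixMultiplication-5014 · crux · rank 2 · open · by planner
why it might fail: if ω>2, dropping or perturbing an η-fraction of the n³ products may lower the exponent (support deletion does lower ranks: ⟨2,2,2⟩ minus the two c₂₂-terms has border rank 5, BiniEtAl1979; KarppaKaski2019); the only transfer known is the incoherent rate error×rank = const.
sources: Schonhage1981, BurgisserClausenShokrollahi1997, BiniEtAl1979, KarppaKaski2019, DesilvaLim2008
[crux] for every η ∈ (0,1) and β: if for all large n some tensor S_n of rank ≤ C n^β has ‖⟨n,n,n⟩ −
S_n‖² ≤ η n³, then ω(ℂ) ≤ β (ω^ap(η) = ω: approximation to constant relative mean-square error buys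
no exponent; card item R). Equivalent, given Flatness and LowerFrame, to the transfer form "from an
η-approximant of rank r at size n, an exact ⟨m,m,m⟩ with m ≥ n^{1−δ} of rank ≤ C_δ n^δ r".
[difficulty: open-problem] -/
@[route_item "route-MatrixMultiplication-ApproximationProfile", crux]
def Rigidity : Prop :=
  ∀ η β : ℝ, 0 < η → η < 1 → (∃ C : ℝ, ∃ N : ℕ, ∀ n : ℕ, N ≤ n → ∃ S : Fin n × Fin n → Fin n × Fin n → Fin n × Fin n → ℂ, (Literature.Computability.AlgebraicComplexity.tensorRank S : ℝ) ≤ C * (n : ℝ) ^ β ∧ ∑ a, ∑ b, ∑ c, ‖Literature.Computability.AlgebraicComplexity.matMulTensor ℂ n n n a b c - S a b c‖ ^ 2 ≤ η * (n : ℝ) ^ 3) → Literature.Computability.AlgebraicComplexity.omega ℂ ≤ β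

/-- item stmt-MatrixMultiplication-5015 · crux · rank 3 · open · by planner
why it might fail: if ω>2 and Rigidity holds it is false; every known sub-cubic approximant is incoherent (sketches: error·rank ≈ n³, Pagh 2013, Cohen–Nelson–Woodruff 2016) or an exact algorithm on a (1−η)-sub-product (rank ≈ (1−η)n^ω); NuclearMass forces term mass ≥ (1−√η)n³.
sources: Pagh2013, arXiv:1108.1320, arXiv:1507.02268, AlonEtAl2013, Blaser2013
[crux] there is ONE η ∈ (0,1) such that for every ε > 0 and all large n some tensor of rank ≤ C_ε
n^{2+ε} is within squared Frobenius distance η n³ of ⟨n,n,n⟩ (ω^ap(η) ≤ 2: coherent approximate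
matrix multiplication at quadratic cost; card item S). [difficulty: open-problem] -/
@[route_item "route-MatrixMultiplication-ApproximationProfile", crux]
def Softness : Prop :=
  ∃ η : ℝ, 0 < η ∧ η < 1 ∧ ∀ ε : ℝ, 0 < ε → ∃ C : ℝ, ∃ N : ℕ, ∀ n : ℕ, N ≤ n → ∃ S : Fin n × Fin n → Fin n × Fin n → Fin n × Fin n → ℂ, (Literature.Computability.AlgebraicComplexity.tensorRank S : ℝ) ≤ C * (n : ℝ) ^ (2 + ε) ∧ ∑ a, ∑ b, ∑ c, ‖Literature.Computability.AlgebraicComplexity.matMulTensor ℂ n n n a b c - S a b c‖ ^ 2 ≤ η * (n : ℝ) ^ 3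

/-- item stmt-MatrixMultiplication-5016 · crux · rank 4 · open · by planner
why it might fail: needs |S||T||U| = n³ at the TPP packing limit |G|^{3/2−o(1)} together with R(ℂ[G]) = |G|^{1+o(1)}; abelian G are impossible (Fourier positivity: ≥ n⁶/|G| − n³ spurious solutions, so |G| ≥ n³/(1+η)) and small-irrep groups are nearly abelian (arXiv:2204.03826-type barriers).
sources: CohnUmans2003, CohnKleinbergSzegedyUmans2005, arXiv:1207.6528, BlasiakCohnGrochowPrattUmans2023, arXiv:1712.02302
[crux] approximate Cohn–Umans embeddings as the coherent source for Softness: ONE η ∈ (0,1) such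
that for every ε > 0 and all large n there are a finite group G with R(ℂ[G]) ≤ C_ε n^{2+ε}
(structure tensor `groupTensor ℂ G`) and three n-tuples s, t, u in G for which the equation (s_b⁻¹
t_{b′})(t_c⁻¹ u_{c′}) = s_a⁻¹ u_{a′} has at most η n³ NON-trivial index solutions (trivial = the n³
matrix-multiplication triples); the restriction of the group tensor along the Cohn–Umans maps is
then an η-approximant of ⟨n,n,n⟩ (item GroupSoftnessGlue). [deps: Softness] [difficulty:
open-problem] -/
@[route_item "route-MatrixMultiplication-ApproximationProfile"]
def GroupSoftness : Prop :=
  ∃ η : ℝ, 0 < η ∧ η < 1 ∧ ∀ ε : ℝ, 0 < ε → ∃ C : ℝ, ∃ N : ℕ, ∀ n : ℕ, N ≤ n → ∃ (G : Type) (_ : Group G) (_ : Fintype G) (_ : DecidableEq G) (s t u : Fin n → G), (Literature.Computability.AlgebraicComplexity.tensorRank (Literature.Computability.AlgebraicComplexity.groupTensor ℂ G) : ℝ) ≤ C * (n : ℝ) ^ (2 + ε) ∧ ((Finset.univ.filter fun p : (Fin n × Fin n) × (Fin n × Fin n) × (Fin n × Fin n) => (s p.2.1.1)⁻¹ * t p.2.1.2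 * ((t p.2.2.1)⁻¹ * u p.2.2.2) = (s p.1.1)⁻¹ * u p.1.2 ∧ ¬ (p.1.1 = p.2.1.1 ∧ p.2.1.2 = p.2.2.1 ∧ p.1.2 = p.2.2.2)).card : ℝ) ≤ η * (n : ℝ) ^ 3

/-- item stmt-MatrixMultiplication-5017 · crux · rank 5 · open · by planner
why it might fail: Mirsky stability of the commutator/Koszul flattening needs its small singular values sparse near 0 after the random restriction ℂ^{n²}→ℂ³; a hard-edge pile-up, or errors aligned with every well-conditioned restriction, would cap error-robust bounds at (1−θ)n²+o(n²).
sources: Strassen1983, LandsbergOttaviani2015, Mirsky1960, EfremenkoGargOliveiraWigderson2018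
[crux] some lower bound beyond the flattening bound survives constant error: there are θ > 0, γ > 0
and N such that for n ≥ N every tensor S with ‖⟨n,n,n⟩ − S‖² ≤ θ n³ has R(S) ≥ (1+γ) n²
(Eckart–Young gives only (1−θ)n²; expected via Mirsky-stable Koszul/commutator flattenings after a
random restriction ℂ^{n²} → ℂ³ of one factor, heuristically (3/2 − O(θ^{1/3}))n²). First rung of the
metric refutation prong r_n(η) ≥ n^{2+δ} (which would imply route BorderRankLowerBound's FThesis and
¬ω=2). [difficulty: L] -/
@[route_item "route-MatrixMultiplication-ApproximationProfile"]
def MetricStrassen : Prop :=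
  ∃ θ : ℝ, 0 < θ ∧ ∃ γ : ℝ, 0 < γ ∧ ∃ N : ℕ, ∀ n : ℕ, N ≤ n → ∀ S : Fin n × Fin n → Fin n × Fin n → Fin n × Fin n → ℂ, ∑ a, ∑ b, ∑ c, ‖Literature.Computability.AlgebraicComplexity.matMulTensor ℂ n n n a b c - S a b c‖ ^ 2 ≤ θ * (n : ℝ) ^ 3 → (1 + γ) * (n : ℝ) ^ 2 ≤ (Literature.Computability.AlgebraicComplexity.tensorRank S : ℝ)

/-- item stmt-MatrixMultiplication-0586 · support · rank 9 · closed · proved by Summit.MatrixMultiplication.MatrixMultiplication.Theorems.omegaGeTwo_proof @ cbdcc04c67d9 (prover) · by planner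
sources: Blaser2013
Lower frame shared by all positive routes: admissibleExponents ℂ is bounded below and 2 ≤ ω(ℂ), from
the flattening bound R(<n,n,n>) ≥ n^2 (Blaser2013 §5–6; BurgisserClausenShokrollahi1997 (15.?)
conciseness) and n^2 = O(n^β) ⇒ β ≥ 2. -/
@[route_item "route-MatrixMultiplication-ApproximationProfile"]
def OmegaGeTwo : Prop :=
  BddBelow (Literature.Computability.AlgebraicComplexity.admissibleExponents ℂ) ∧ 2 ≤ Literature.Computability.AlgebraicComplexity.omega ℂ

/-- `OmegaGeTwo` holds: proved by `Summit.MatrixMultiplication.MatrixMultiplication.Theorems.omegaGeTwo_proof` @ cbdcc04c67d9. -/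
theorem OmegaGeTwo_holds : OmegaGeTwo := _root_.Summit.MatrixMultiplication.MatrixMultiplication.Theorems.omegaGeTwo_proof

/-- item stmt-MatrixMultiplication-5018 · support · rank 9 · open · by planner
sources: Mirsky1960, DesilvaLim2008, Blaser2013
[support] Eckart–Young floor: for every n and every tensor S, (n² − R(S))·n ≤ ‖⟨n,n,n⟩ − S‖² (the
flattening of ⟨n,n,n⟩ has n² singular values √n and a rank-r tensor has flattening rank ≤ r); hence
r_n(η) ≥ (1−η)n² and ω^ap(η) ≥ 2. [difficulty: provable-now] -/
@[route_item "route-MatrixMultiplication-ApproximationProfile"]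
def LowerFrame : Prop :=
  ∀ (n : ℕ) (S : Fin n × Fin n → Fin n × Fin n → Fin n × Fin n → ℂ), ((n : ℝ) ^ 2 - (Literature.Computability.AlgebraicComplexity.tensorRank S : ℝ)) * (n : ℝ) ≤ ∑ a, ∑ b, ∑ c, ‖Literature.Computability.AlgebraicComplexity.matMulTensor ℂ n n n a b c - S a b c‖ ^ 2

/-- item stmt-MatrixMultiplication-5019 · support · rank 9 · open · by planner
sources: Derksen2015, Blaser2013
[support] mass constraint on approximants (retired card approximate-exponent): the spectral norm of
⟨n,n,n⟩ is 1 (|Σ A_{κμ}B_{μν}C_{κν}| = |tr(ABCᵀ)| ≤ ‖A‖‖B‖‖C‖), so any decomposition Σ_{i<r}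
u_i⊗v_i⊗w_i within squared error η n³ of ⟨n,n,n⟩ has Σ_i ‖u_i‖‖v_i‖‖w_i‖ ≥ (1−√η) n³ —
rank-n^{2+o(1)} softness needs terms of average mass n^{1−o(1)}. [difficulty: provable-now] -/
@[route_item "route-MatrixMultiplication-ApproximationProfile"]
def NuclearMass : Prop :=
  ∀ (η : ℝ) (n r : ℕ) (u v w : Fin r → Fin n × Fin n → ℂ), 0 ≤ η → ∑ a, ∑ b, ∑ c, ‖Literature.Computability.AlgebraicComplexity.matMulTensor ℂ n n n a b c - (∑ i, Literature.Computability.AlgebraicComplexity.triad (u i) (v i) (w i)) a b c‖ ^ 2 ≤ η * (n : ℝ) ^ 3 → (1 - Real.sqrt η) * (n : ℝ) ^ 3 ≤ ∑ i, Real.sqrt (∑ a, ‖u i a‖ ^ 2) * Real.sqrt (∑ b, ‖v i b‖ ^ 2) * Real.sqrt (∑ c, ‖w i c‖ ^ 2)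

/-- item stmt-MatrixMultiplication-5020 · support · rank 9 · open · by planner
sources: Blaser2013, DesilvaLim2008
[support] error amplification at constant rank cost (ω^ap is constant on (0,1)): for η ∈ (0,1) and
η′ > 0 there is N = N(η,η′) (N = ⌈η/(η′(1−η))⌉ works) such that every S with error ≤ η n³ yields S′
with R(S′) ≤ N·R(S) and error ≤ η′ n³. Proof sketch: rescale S so that ⟨⟨n,n,n⟩ − S, S⟩ = 0; average
N conjugates g_i·S over a finite irreducible subgroup of the stabiliser U(n)³ (signed permutations
suffice: first moments only), whose invariants on ℂ^{n²}⊗ℂ^{n²}⊗ℂ^{n²} are ℂ·⟨n,n,n⟩; the component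
of the error orthogonal to ⟨n,n,n⟩ averages out at rate 1/N; rescale. [difficulty: M] -/
@[route_item "route-MatrixMultiplication-ApproximationProfile"]
def Flatness : Prop :=
  ∀ η η' : ℝ, 0 < η → η < 1 → 0 < η' → ∃ N : ℕ, ∀ (n : ℕ) (S : Fin n × Fin n → Fin n × Fin n → Fin n × Fin n → ℂ), ∑ a, ∑ b, ∑ c, ‖Literature.Computability.AlgebraicComplexity.matMulTensor ℂ n n n a b c - S a b c‖ ^ 2 ≤ η * (n : ℝ) ^ 3 → ∃ S' : Fin n × Fin n → Fin n × Fin n → Fin n × Fin n → ℂ, Literature.Computability.AlgebraicComplexity.tensorRank S' ≤ N * Literature.Computability.AlgebraicComplexity.tensorRank S ∧ ∑ a, ∑ b, ∑ c, ‖Literature.Computability.AlgebraicComplexity.matMulTensor ℂ n n n a b c - S' a b c‖ ^ 2 ≤ η' * (n : ℝ) ^ 3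

/-- item stmt-MatrixMultiplication-5021 · support · rank 9 · open · by planner
sources: Blaser2013, DesilvaLim2008
[support] the card's decoherence lemma (v) in safe form: for η ∈ (0,1), η′ > 0 there is κ > 0 (κ =
min(1, η′(1−η)/η) works) such that every S with error ≤ η n³ at size n yields, for every m ≤ min(n,
κ n), a tensor S′ at size m with R(S′) ≤ R(S) and error ≤ η′ m³. Proof sketch: rescale, twirl by a
Haar (or unitary-2-design) element of U(n)³, restrict to an m-sub-product; each error sector with k
≥ 1 traceless legs keeps an expected energy fraction (m/n)^{3−k}·(m(mn−1)/(n(n²−1)))^k ≤ (m/n)^4,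
versus (m/n)³ for ⟨n,n,n⟩, so the relative error drops by m/n. [difficulty: L] -/
@[route_item "route-MatrixMultiplication-ApproximationProfile"]
def DecoherenceStep : Prop :=
  ∀ η η' : ℝ, 0 < η → η < 1 → 0 < η' → ∃ κ : ℝ, 0 < κ ∧ ∀ (n m : ℕ) (S : Fin n × Fin n → Fin n × Fin n → Fin n × Fin n → ℂ), m ≤ n → (m : ℝ) ≤ κ * n → ∑ a, ∑ b, ∑ c, ‖Literature.Computability.AlgebraicComplexity.matMulTensor ℂ n n n a b c - S a b c‖ ^ 2 ≤ η * (n : ℝ) ^ 3 → ∃ S' : Fin m × Fin m → Fin m × Fin m → Fin m × Fin m → ℂ, Literature.Computability.AlgebraicComplexity.tensorRank S' ≤ Literature.Computability.AlgebraicComplexity.tensorRank S ∧ ∑ a, ∑ b, ∑ c, ‖Literature.Computability.AlgebraicComplexity.matMulTensor ℂ m m m a b c - S' a b c‖ ^ 2 ≤ η' * (m : ℝ) ^ 3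

/-- item stmt-MatrixMultiplication-5022 · support · rank 9 · open · by planner
sources: Schonhage1981, BurgisserClausenShokrollahi1997
[support] Rigidity restricted to Schönhage's partial matrix multiplications (0/1-approximants
keeping the products (κ,μ,ν) with (κ,μ) ∈ I, (μ,ν) ∈ J, f = |T| ≥ (1−η)n³ of the n³ ones): rank ≤ C
n^β for all large n ⇒ ω ≤ β. A special case of Rigidity (error = n³ − f) AND a consequence of
BurgisserClausenShokrollahi1997 Thm (15.48) (f^{ω/3} ≤ R̲ ≤ R, so ω ≤ 3 log(C n^β)/log((1−η)n³) →
β); provable once that theorem is available as a Literature fact (cite item filed). [difficulty: L] -/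
@[route_item "route-MatrixMultiplication-ApproximationProfile"]
def PatternRigidity : Prop :=
  ∀ η β : ℝ, 0 < η → η < 1 → (∃ C : ℝ, ∃ N : ℕ, ∀ n : ℕ, N ≤ n → ∃ I J : Finset (Fin n × Fin n), (1 - η) * (n : ℝ) ^ 3 ≤ ((Finset.univ.filter fun p : Fin n × Fin n × Fin n => (p.1, p.2.1) ∈ I ∧ (p.2.1, p.2.2) ∈ J).card : ℝ) ∧ (Literature.Computability.AlgebraicComplexity.tensorRank (fun (a b c : Fin n × Fin n) => if b ∈ I ∧ c ∈ J then Literature.Computability.AlgebraicComplexity.matMulTensor ℂ n n n a b c else 0) : ℝ) ≤ C * (n : ℝ) ^ β) → Literature.Computability.AlgebraicComplexity.omega ℂ ≤ β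

/-- item stmt-MatrixMultiplication-5023 · support · rank 9 · open · by planner
sources: CohnUmans2003
[support] glue of the foreseen one-child split Softness ⇐ GroupSoftness: the restriction of
`groupTensor ℂ G` along b=(s,t) ↦ s_b⁻¹t_{b′}, c=(t,u) ↦ t_c⁻¹u_{c′}, a=(s,u) ↦ s_a⁻¹u_{a′} has rank
≤ R(ℂ[G]) (`tensorRank_comp_le`), agrees with ⟨n,n,n⟩ on the trivial triples and has squared error =
the number of non-trivial solutions (CohnUmans2003 Thm 2.3 with the TPP hypothesis dropped).
[difficulty: provable-now] -/
@[route_item "route-MatrixMultiplication-ApproximationProfile"]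
def GroupSoftnessGlue : Prop :=
  GroupSoftness → Softness

/-- item stmt-MatrixMultiplication-5024 · assembly · rank 1 · open · by planner
sources: Blaser2013
[assembly] Rigidity → Softness → MatrixMultiplication (ω(ℂ) = 2). -/
@[route_item "route-MatrixMultiplication-ApproximationProfile"]
def Assembly : Prop :=
  Rigidity → Softness → MatrixMultiplication

/-! D-0027 §2.1 — DECIDING THEOREM (planner-authored via `route open/edit --closes-file`; by planner-rbadge-MatrixMultiplication-Approximat-62078989-g2-0 2026-08-15T16:12:48Z):
its hypotheses are this route's items and its conclusion the sub-problem Statement (glue_lint), and it elaborates with this file. -/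

/-- DECIDING THEOREM (D-0027 §2.1): Softness supplies one η ∈ (0,1) and, for every ε > 0,
rank-O(n^{2+ε}) approximants of ⟨n,n,n⟩ within squared error η n³; Rigidity at (η, β = 2+ε) turns
them into ω(ℂ) ≤ 2+ε; hence ω(ℂ) ≤ 2, and the proved flattening bound `omega_two_le`
(Literature/…/FlatteningBound.lean, in the cone) gives ω(ℂ) = 2 = `MatrixMultiplication`. -/
@[closes "route-MatrixMultiplication-ApproximationProfile"] theorem closes (hR : Rigidity) (hS : Softness) : MatrixMultiplication := by
  rw [MatrixMultiplication_iff]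
  refine le_antisymm ?_ (Literature.Computability.AlgebraicComplexity.omega_two_le ℂ)
  obtain ⟨η, hη0, hη1, hsoft⟩ := hS
  exact le_of_forall_pos_le_add fun ε hε => hR η (2 + ε) hη0 hη1 (hsoft ε hε)

end Summit.MatrixMultiplication.MatrixMultiplication.Theses.ApproximationProfile
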